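import Mathlib.Combinatorics.Matroid.Closure
import Mathlib.LinearAlgebra.Dimension.OrzechProperty
import Mathlib.Algebra.BigOperators.Pi
import Literature.MathematicalPhysics.QuantumFieldTheory.Volkov2020.HeppSectorTreeBounds
import Literature.MathematicalPhysics.QuantumFieldTheory.HeppBound
import HarnessLib

/-!
# Volkov 2020 (NPB 961, 115232) Lemma 3.9 — the COMBINATORIAL CORE of its proof: the 1-tree exchange `T′ = T ∪ {j} ∖ {i}` along the lepton path of a photon `i ∈ T` and the bound `X′_T ≤ 1/(1 + z_i/z_j) ≤ z′_i / max(z′_i, z_i)` — PROVED, matroid-generally over `D(z)`, with the graph input discharged for the cycle matroid of an edge list; and (§6) its consequence at the level of the coefficients of Q″_l = (Q_l(z) − q_l D(z))/D(z): |coordinate| ≤ 2(#1-trees − 1)·max_{i∈Ph} z′_i/max(z′_i, z_i) — the right-hand side of (3.11) with an explicit structure constant, the momentum-routing data entering as hypotheses |c(T)| ≤ 1, c(Lept) = c₀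

independent recomputation; certified where stated, statistical where stated; no new-physics claim.

CITATION HEADER (venture `QEDPrecision`, cell `pub-qed`, track TROPICAL seat V3b = `pub-qed-trop-v3-lit-2` gen 9, §6 appended by gen 11; VALUE-FREE: combinatorics of
1-trees / bases, incidence vectors and one monomial inequality — no Feynman integrand, nothing per word). Companion of
`Volkov2020.HeppSectorTreeBounds` (§3.1, whose `treeSum` = D(z) and `oneTrees` are used here), `Volkov2020.DenominatorSectorExponent` /
`CapturedPhotonBound` (§3.2), `Volkov2020.OnShellDenominatorCircuit` (Lemma 3.4 with fn 23, whose `zMax` is the same z′_i on the ℕ-indexed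
skeleton) and `Volkov2020.PositiveDegreesBookkeeping` (§3.3 / Theorem 3.1, whose one-screen kernel status in `tropical/view/V3-VOLKOV-DEGREES.md`
§B.29.3 lists «§3.3 Lemma 3.8, Lemma 3.9 (3.11): ✗ (analytic / γ-matrix identities)» — this file certifies the half of Lemma 3.9 that is NOT
γ-matrix algebra); serves §B.31 of that view file.

Source. [Volkov2020] S. Volkov, "Infrared and ultraviolet power counting on the mass shell in quantum electrodynamics", Nucl. Phys. B 961
(2020) 115232 = arXiv:1912.04885v4 (e-print tex `iclos_arxiv.tex`, sha256 8613757ca2360833…, held by the cell under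
`pub-qed-trop-v3-lit-2/sources/arxiv-1912.04885/`; numbering by section = the journal's, concordance §B.11.1), VERBATIM:
* §2.1 (journal p.7; tex l.150–170): "A set s ⊆ E(G): is called an *1-tree*, if there is a path in s between any v₁,v₂ ∈ V(G) and s does not
  have cycles … We suppose that G does not have lepton cycles … If i ∈ Ph(E(G)), then by LPath(i) we denote the set of all lines that are
  on the lepton path connecting the vertexes incident to i."
* §2.2.1 (journal p.8; tex l.213–218, l.234–239): "D(z) = Σ_T ∏_{l∈E(G)∖T} z_l, the summation goes over all 1-trees in G." and "Q_l(z) =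
  Σ_T p[T] ∏_{l′∈E(G)∖T} z_{l′}, where the summation goes over all 1-trees T containing l, by p[T] we denote the momentum that passes through l
  in T".
* Lemma 3.4 (journal p.12; tex l.366–368): "z′_i = max_{l∈LPath(i)} z_l".
* **Lemma 3.9** (journal p.16; tex l.525–531): "If |P| = 0, then the following inequality is satisfied in terms of (3.1):
  |Σ_{j:P_j=P} [𝒫Π_j] Y_j(z)| ≤ C · max_{i∈Ph(E(G))} z′_i/max(z′_i, z_i), (3.11) where C is some constant that depends only on the structure
  of the graph (and m), z′_i are defined in Lemma 3.4."
* **its proof, second half** (journal p.16–17; tex l.541–556): "… it is sufficient to estimate the coefficients of Q″_l. We have Q″_l =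
  (Q_l(z) − q_l D(z))/D(z). Both terms of the numerator can be expressed as sums of the form Σ_T c(T) ∏_{l∈E(G)∖T} z_l, where the summation
  goes over 1-trees T of G … The terms corresponding to T are cancelled if l ∈ T and the momentum passing through l in T equals q_l …
  Suppose T is not cancelled. By definition, put X′_T = ∏_{l∈E(G)∖T} z_l / D(z). It is obvious that there exists i ∈ Ph(E(G)) such that
  i ∈ T (because T = Lept(E(G)) is cancelled). Let us consider the vertexes v₁,…,v_n of the lepton path connecting the ends of i ordered
  along it. The ends v₁ and v_n of i belong to different connectivity components of T∖i. Therefore, there exists b such that v_b, v_{b+1}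
  belong to the different connectivity components. By j we denote the lepton line connecting v_b and v_{b+1}. It is obvious that j ∉ T
  and T′ = T ∪ {j} ∖ {i} is a 1-tree of G. From the fact that both T and T′ contribute to D(z), it follows that
  X′_T ≤ 1/(1 + z_i/z_j) = 1 − z_i/(z_i+z_j) ≤ 1 − z_i/(z_i+z′_i) = z′_i/(z_i+z′_i) ≤ z′_i/max(z_i,z′_i). This completes the proof."

READING (the modelling steps, as in `HeppSectorTreeBounds`). 1-trees = bases of the cycle matroid (Mathlib's `Matroid`, B.27's `oneTrees`),
D(z) = `treeSum`. The printed connectivity argument "v_b, v_{b+1} belong to the different connectivity components of T∖i" is, for a matroid,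
the statement that the fundamental cocircuit of i in T meets the circuit {i} ∪ LPath(i) in a second element j; we use it in the (equivalent,
Mathlib-ready) closure form: T∖{i} does not span i, but LPath(i) does ("i ∈ closure(LPath(i))": the photon and its lepton path close a
cycle), hence some j ∈ LPath(i) is not spanned by T∖{i}, and `Matroid.IsBase.exchange_base_of_notMem_closure` gives the 1-tree T′. That single
graph input, and "Lept(E(G)) is a 1-tree", are then DISCHARGED (§4) for the tree's own `cycleMatroid E` of an edge list
`E : Fin N → Fin (V+1) × Fin (V+1)` (`QuantumFieldTheory/HeppBound.lean`: the vector matroid over ℚ of Brown's reduced incidence rows,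
`GraphPeriod.reducedIncidence`) whenever the lepton lines run m → m+1 along the vertices 0,…,V and the photon i runs a → b: the incidence
row of i telescopes into the rows of its lepton path. "T is cancelled" (a Dirac-algebra datum: the momentum through l in T equals q_l) is
NOT modelled: the bound is proved for EVERY 1-tree T ≠ Lept(E(G)), which covers all non-cancelled T by the printed remark, and the trivial
`treeShare_le_one` covers T = Lept(E(G)).

WHAT THE KERNEL CERTIFIES (all PROVED; Mathlib + `HeppSectorTreeBounds` + `HeppBound`/`VectorMatroid` only; no named fact, D-0026):
* §1 `exists_exchange_of_mem_closure` (ANY matroid): base B ∋ i, X ⊆ E with i ∉ X, i ∈ closure X ⟹ ∃ j ∈ X, j ∉ B, B ∪ {j} ∖ {i} a base —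
  "j ∉ T and T′ = T ∪ {j} ∖ {i} is a 1-tree of G".
* §2 `treeShare M z T` = **X′_T AS PRINTED**; `add_le_treeSum` ("both T and T′ contribute to D(z)"); `prod_compl_exchange_mul` (the monomial of
  T′ is that of T times z_i/z_j, any commutative monoid); **`treeShare_le_of_exchange`: X′_T ≤ z_j/(z_j + z_i)** ( = 1/(1 + z_i/z_j)) for z > 0;
  `div_add_le_div_max` (the last two printed steps: a/(a+c) ≤ b/(b+c) ≤ b/max(b,c) for 0 < a ≤ b, 0 < c); `treeShare_le_one`; `lineMax z P` =
  **z′ AS PRINTED** (max over a line set) with `le_lineMax`, `exists_lineMax_eq`.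
* §3 **`lemma39_core`** (matroid on the lines `Fin L`; hypotheses: Lept a base, every other line a photon, LPath(i) ⊆ Lept, i ∈ closure(LPath(i))
  for photons): for EVERY base T ≠ Lept there are a photon i ∈ T, i ∉ Lept ("there exists i ∈ Ph(E(G)) such that i ∈ T (because T = Lept(E(G))
  …)" — all bases are equicardinal) and j ∈ LPath(i), j ∉ T with T ∪ {j} ∖ {i} a base and X′_T ≤ z_j/(z_j+z_i); **`lemma39_core_printed`**:
  X′_T ≤ z′_i/max(z′_i, z_i); **`lemma39_core_max`**: X′_T ≤ max_{i∈Ph} z′_i/max(z′_i, z_i) — the right-hand side of (3.11) without C.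
* §4 (edge lists; `vtx V n` = the reduced incidence vector δ_n of vertex n, δ₀ = 0): `mem_closure_vectorMatroid_of_mem_span` (span ⟹ closure in
  a vector matroid); `reducedIncidence_eq_vtx_sub` (a line a → b has row δ_a − δ_b); **`reducedIncidence_eq_sum_path`** (ε(i) = Σ_{m∈[a,b)} ε(lep m)
  when lep m runs m → m+1: telescoping); **`mem_closure_cycleMatroid_of_path`**: such a photon i lies in the closure of any line set containing
  its lepton path — the hypothesis `hcl` of §3 for graphs; **`isBase_cycleMatroid_path`**: lines lep m : m → m+1 (m < V, injective) form a BASE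
  of `cycleMatroid E` (their rows span ℚ^V since e_j = −Σ_{m≤j}(δ_m − δ_{m+1}), and V = dim) — the hypothesis `hLept` of §3 for graphs.
* §5 non-vacuity on the ONE-LOOP vertex graph `oneLoopEdges` (a : 0→1, b : 1→2, γ : 0→2): `oneLoop_isBase_lept`, `oneLoop_photon_mem_closure`
  (instances of §4 by `decide` / `interval_cases`), **`oneLoop_lemma39_core`**: every 1-tree T ≠ {a, b} has X′_T ≤ z′_γ/max(z′_γ, z_γ),
  z′_γ = max(z_a, z_b), for all positive z.
BY-PRODUCT (locator hygiene, not a defect of the source): §2 of the e-print/journal numbers exactly four displays — (2.1) R(z,p) = Σ Π_j R_j,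
(2.2) B_{l₁l₂}(z), (2.3) W(z) = W(z,p,q,0)|_{p²=m², q²=0}, (2.4) W(z) = m²(Z(z) − Z₀(z)); `HeppSectorTreeBounds`' docstrings say "eq. (2.3)" for
B_{l₁l₂}, read (2.2).
* §6 (gen 11) the COEFFICIENTS OF Q″_l: "Q″_l = (Q_l(z) − q_l D(z))/D(z). Both terms of the numerator can be expressed as sums of the form
  Σ_T c(T)∏_{l∈E(G)∖T} z_l … the coefficients c(T) are linear combinations of p₁, p₂. The terms corresponding to T are cancelled if l ∈ T and
  the momentum passing through l in T equals q_l" (tex l.541–546): per coordinate (p₁ or p₂), with `c T` the coordinate of p[T] (T ∋ l) and `c₀`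
  that of q_l, `qCoeff` = that coordinate of Q″_l **AS PRINTED** (Σ over 1-trees ∋ l of c(T)∏z, minus c₀·D, over D); `qWeight` (c(T) − c₀ if
  l ∈ T, −c₀ otherwise); `qWeight_eq_zero_of_cancel` (the printed cancellation); **`qCoeff_eq_sum_qWeight_mul_treeShare`**: the coordinate =
  Σ_T qWeight(T)·X′_T over ALL 1-trees; `treeShare_nonneg`; **`abs_qCoeff_le`**: in the setting of `lemma39_core`, for l ∈ Lept, |c(T)| ≤ 1,
  |c₀| ≤ 1 and c(Lept) = c₀, |coordinate of Q″_l| ≤ 2·(#1-trees − 1)·max_{i∈Ph} z′_i/max(z′_i, z_i) (the Lept term vanishes, every other 1-tree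
  has a photon and obeys `lemma39_core_max`); `oneLoop_abs_qCoeff_le` (non-vacuity on the one-loop graph). MODELLING (flagged): the two
  hypotheses are the momentum-routing facts of a vertex graph — p[T] is the signed sum of the external momenta on one side of l in T, hence
  ∈ {0, ±p₁, ±p₂, ±q} (coordinates in [−1, 1]), and the momentum through l in the pure lepton tree is q_l by the definition of q_l
  ("q_l = p₁ for 1 ≤ l ≤ h and q_l = p₂ for h+1 ≤ l ≤ 2h") — Kirchhoff on trees, NOT formalised here (as "T is cancelled" was not in §3).
NOT claimed: Lemma 3.8 and the γ-matrix side of Lemma 3.9 (the expansion of X into terms with at least one Q̂″_l — a separate file of this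
story treats them), "all other multipliers … with coefficients that are less or equal 1" beyond `treeShare_le_one`, the momentum-routing
facts just named, and the constant C of (3.11) as a statement about the numbers [𝒫Π_j] (𝒫 as a functional is not in the tree), hence (3.11)
itself and (3.12)–(3.13); the matrix-tree identification of D, Q_l with determinants of `GraphPeriod.graphMatrix`; lepton loops; anything per
word of the cell.
-/

namespace Literature.MathematicalPhysics.QuantumFieldTheory.Volkov2020

open Finset

noncomputable section

/-! ## §1 The 1-tree exchange along a cycle (any matroid) -/

section Exchange

variable {α : Type*} {M : Matroid α}

/-- **The exchange step of the proof of Lemma 3.9, matroid form.** If a base ("1-tree") `B` contains a line `i` that lies in the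
closure of a line set `X` not containing it (for a graph: the photon `i` together with its lepton path `X` closes a cycle), then some
`j ∈ X` outside `B` can be exchanged for `i`: `B ∪ {j} ∖ {i}` is again a base — "there exists b such that v_b, v_{b+1} belong to the
different connectivity components … j ∉ T and T′ = T ∪ {j} ∖ {i} is a 1-tree of G". (The matroid fact: the fundamental cocircuit of
`i` in `B` meets every circuit through `i` in a second element; Oxley 2011 §1.2, §2.1.)
[cite: Volkov2020, proof of Lemma 3.9 (journal p.16–17; arXiv:1912.04885v4 tex l.549–552)] -/
theorem exists_exchange_of_mem_closure {B : Set α} (hB : M.IsBase B) {i : α} (hi : i ∈ B)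
    {X : Set α} (hXE : X ⊆ M.E) (hiX : i ∉ X) (hcl : i ∈ M.closure X) :
    ∃ j ∈ X, j ∉ B ∧ M.IsBase (insert j (B \ {i})) := by
  have hni : i ∉ M.closure (B \ {i}) := hB.indep.notMem_closure_sdiff_of_mem hi
  obtain ⟨j, hjX, hj⟩ : ∃ j ∈ X, j ∉ M.closure (B \ {i}) := by
    by_contra h
    push Not at h
    exact hni (M.closure_subset_closure_of_subset_closure h hcl)
  have hjB : j ∉ B := by
    intro hjB
    refine hj (M.subset_closure (B \ {i}) (Set.sdiff_subset.trans hB.subset_ground) ⟨hjB, ?_⟩)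
    rintro (rfl : j = i)
    exact hiX hjX
  exact ⟨j, hjX, hjB, hB.exchange_base_of_notMem_closure hi hj (hXE hjX)⟩

end Exchange

/-! ## §2 `X′_T` and its bound through the exchanged 1-tree (lines `Fin L`, `D(z) = treeSum`) -/

section Share

variable {L : ℕ}

/-- **X′_T AS PRINTED**: `X′_T = ∏_{l∈E(G)∖T} z_l / D(z)`, the share of the 1-tree `T` in `D(z) = Σ_T ∏_{l∉T} z_l`
(`treeSum` of `HeppSectorTreeBounds`). [cite: Volkov2020, proof of Lemma 3.9 (journal p.16; arXiv:1912.04885v4 tex l.545–548)] -/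
def treeShare (M : Matroid (Fin L)) (z : Fin L → ℝ) (T : Finset (Fin L)) : ℝ :=
  (∏ k ∈ univ \ T, z k) / treeSum M z

/-- Two distinct 1-trees contribute two distinct (nonnegative) terms to `D(z)`: "both T and T′ contribute to D(z)".
[cite: Volkov2020, proof of Lemma 3.9 (journal p.17; arXiv:1912.04885v4 tex l.552–553)] -/
theorem add_le_treeSum (M : Matroid (Fin L)) (z : Fin L → ℝ) (hz : ∀ k, 0 ≤ z k) {T T' : Finset (Fin L)}
    (hT : M.IsBase (T : Set (Fin L))) (hT' : M.IsBase (T' : Set (Fin L))) (hne : T ≠ T') :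
    (∏ k ∈ univ \ T, z k) + ∏ k ∈ univ \ T', z k ≤ treeSum M z := by
  unfold treeSum
  rw [← sum_pair (f := fun S : Finset (Fin L) => ∏ k ∈ univ \ S, z k) hne]
  refine sum_le_sum_of_subset_of_nonneg ?_ (fun S _ _ => prod_nonneg fun k _ => hz k)
  intro S hS
  rw [mem_insert, mem_singleton] at hS
  rcases hS with rfl | rfl
  · exact (mem_oneTrees M).2 hT
  · exact (mem_oneTrees M).2 hT'

/-- The monomial of the exchanged 1-tree: `(∏_{l∉T∪{j}∖{i}} z_l) · z_j = (∏_{l∉T} z_l) · z_i` — the printed "1/(1 + z_i/z_j)".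
[cite: Volkov2020, proof of Lemma 3.9 (journal p.17; arXiv:1912.04885v4 tex l.552–554)] -/
theorem prod_compl_exchange_mul {R : Type*} [CommMonoid R] (z : Fin L → R) {T : Finset (Fin L)} {i j : Fin L}
    (hi : i ∈ T) (hj : j ∉ T) :
    (∏ k ∈ univ \ insert j (T.erase i), z k) * z j = (∏ k ∈ univ \ T, z k) * z i := by
  have hij : i ≠ j := fun h => hj (h ▸ hi)
  set S : Finset (Fin L) := (univ \ T).erase j with hS
  have h1 : univ \ T = insert j S := by
    rw [hS, insert_erase (mem_sdiff.2 ⟨mem_univ _, hj⟩)]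
  have h2 : univ \ insert j (T.erase i) = insert i S := by
    ext k
    simp only [hS, mem_sdiff, mem_univ, true_and, mem_insert, mem_erase]
    by_cases hki : k = i
    · subst hki
      simp [hij, hi]
    · simp [hki, not_or]
  have hjS : j ∉ S := fun h => (mem_erase.1 h).1 rfl
  have hiS : i ∉ S := fun h => (mem_sdiff.1 (mem_erase.1 h).2).2 hi
  rw [h1, h2, prod_insert hjS, prod_insert hiS]
  simp only [mul_comm, mul_left_comm]

/-- **"Both T and T′ contribute to D(z)" ⟹ `X′_T ≤ 1/(1 + z_i/z_j) = z_j/(z_j + z_i)`**: for positive parameters, a 1-tree `T ∋ i`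
and a line `j ∉ T` with `T ∪ {j} ∖ {i}` again a 1-tree. [cite: Volkov2020, proof of Lemma 3.9 (journal p.17; arXiv:1912.04885v4 tex l.552–554)] -/
theorem treeShare_le_of_exchange (M : Matroid (Fin L)) (z : Fin L → ℝ) (hz : ∀ k, 0 < z k)
    {T : Finset (Fin L)} (hT : M.IsBase (T : Set (Fin L))) {i j : Fin L} (hi : i ∈ T) (hj : j ∉ T)
    (hT' : M.IsBase ((insert j (T.erase i) : Finset (Fin L)) : Set (Fin L))) :
    treeShare M z T ≤ z j / (z j + z i) := by
  have hne : T ≠ insert j (T.erase i) := by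
    intro h
    exact hj (by rw [h]; exact mem_insert_self j _)
  have hsum := add_le_treeSum M z (fun k => (hz k).le) hT hT' hne
  have hA : 0 < ∏ k ∈ univ \ T, z k := prod_pos fun k _ => hz k
  have hA' : 0 < ∏ k ∈ univ \ insert j (T.erase i), z k := prod_pos fun k _ => hz k
  have hex := prod_compl_exchange_mul z hi hj
  have hD : 0 < treeSum M z := lt_of_lt_of_le (add_pos hA hA') hsum
  unfold treeShare
  rw [div_le_div_iff₀ hD (add_pos (hz j) (hz i))]
  calc (∏ k ∈ univ \ T, z k) * (z j + z i)
      = z j * ((∏ k ∈ univ \ T, z k) + ∏ k ∈ univ \ insert j (T.erase i), z k) := by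
        rw [mul_add, ← hex]; ring
    _ ≤ z j * treeSum M z := mul_le_mul_of_nonneg_left hsum (hz j).le

/-- The two elementary steps closing the printed chain: for `0 < a ≤ b` and `0 < c`,
`a/(a + c) ≤ b/(b + c) ≤ b/max(b, c)` ("1 − z_i/(z_i+z_j) ≤ 1 − z_i/(z_i+z′_i) = z′_i/(z_i+z′_i) ≤ z′_i/max(z_i,z′_i)").
[cite: Volkov2020, proof of Lemma 3.9 (journal p.17; arXiv:1912.04885v4 tex l.553–554)] -/
theorem div_add_le_div_max {a b c : ℝ} (ha : 0 < a) (hab : a ≤ b) (hc : 0 < c) :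
    a / (a + c) ≤ b / (b + c) ∧ b / (b + c) ≤ b / max b c := by
  have hb : 0 < b := lt_of_lt_of_le ha hab
  refine ⟨?_, ?_⟩
  · rw [div_le_div_iff₀ (add_pos ha hc) (add_pos hb hc)]
    nlinarith
  · exact div_le_div_of_nonneg_left hb.le (lt_max_of_lt_left hb) (max_le (by linarith) (by linarith))

/-- Every 1-tree's share is at most 1 (a single nonnegative term of `D`); this is the trivial bound for the remaining
multipliers "with coefficients that are less or equal 1". [cite: Volkov2020, proof of Lemma 3.9 (journal p.16; arXiv:1912.04885v4 tex l.541)] -/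
theorem treeShare_le_one (M : Matroid (Fin L)) (z : Fin L → ℝ) (hz : ∀ k, 0 < z k) {T : Finset (Fin L)}
    (hT : M.IsBase (T : Set (Fin L))) : treeShare M z T ≤ 1 := by
  have hA : 0 < ∏ k ∈ univ \ T, z k := prod_pos fun k _ => hz k
  have hle : ∏ k ∈ univ \ T, z k ≤ treeSum M z := by
    unfold treeSum
    exact single_le_sum (f := fun S : Finset (Fin L) => ∏ k ∈ univ \ S, z k)
      (fun S _ => prod_nonneg fun k _ => (hz k).le) ((mem_oneTrees M).2 hT)
  unfold treeShare
  exact div_le_one_of_le₀ hle (hA.le.trans hle)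

/-- `z′_i` **AS PRINTED** (Lemma 3.4): `z′_i = max_{l∈LPath(i)} z_l`, for a line set `P` (junk value 0 when `P = ∅`).
[cite: Volkov2020, Lemma 3.4 (journal p.12; arXiv:1912.04885v4 tex l.366–368)] -/
def lineMax (z : Fin L → ℝ) (P : Finset (Fin L)) : ℝ :=
  if h : P.Nonempty then P.sup' h z else 0

/-- `z_l ≤ z′` for `l` on the path. [cite: Volkov2020, Lemma 3.4 (journal p.12; arXiv:1912.04885v4 tex l.366–368)] -/
theorem le_lineMax (z : Fin L → ℝ) {P : Finset (Fin L)} {k : Fin L} (hk : k ∈ P) : z k ≤ lineMax z P := by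
  unfold lineMax
  rw [dif_pos ⟨k, hk⟩]
  exact le_sup' z hk

/-- The maximum is attained on a nonempty path. [cite: Volkov2020, Lemma 3.4 (journal p.12; arXiv:1912.04885v4 tex l.366–368)] -/
theorem exists_lineMax_eq (z : Fin L → ℝ) {P : Finset (Fin L)} (hP : P.Nonempty) : ∃ k ∈ P, lineMax z P = z k := by
  unfold lineMax
  rw [dif_pos hP]
  exact exists_mem_eq_sup' hP z

end Share

/-! ## §3 Lemma 3.9's combinatorial core, assembled -/

section Core

variable {L : ℕ}

/-- **NPB 961 Lemma 3.9 — the combinatorial core of its proof, PROVED (matroid-general).** Lines `Fin L`; `Lept` = the lepton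
lines, a 1-tree ("T = Lept(E(G))", the lepton path of a graph without lepton loops is a spanning tree); every other line is a
photon (`Ph`); each photon `i` has a lepton path `LPath(i) ⊆ Lept` with `i ∈ closure(LPath(i))` (for the cycle matroid of the graph:
the photon and its lepton path form a cycle — discharged for edge lists in §4). Then for EVERY 1-tree `T ≠ Lept(E(G))` ("T is not
cancelled … T = Lept(E(G)) is cancelled") there are a photon `i ∈ T` and a lepton line `j ∈ LPath(i)`, `j ∉ T`, such that
`T′ = T ∪ {j} ∖ {i}` is a 1-tree and `X′_T ≤ z_j/(z_j + z_i)` ( = the printed `1/(1 + z_i/z_j)`), for all positive parameters `z`.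
[cite: Volkov2020, proof of Lemma 3.9 (journal p.16–17; arXiv:1912.04885v4 tex l.545–556)] -/
theorem lemma39_core (M : Matroid (Fin L)) (z : Fin L → ℝ) (hz : ∀ k, 0 < z k)
    (Ph Lept : Finset (Fin L)) (lpath : Fin L → Finset (Fin L))
    (hcover : ∀ l, l ∉ Lept → l ∈ Ph) (hLept : M.IsBase (Lept : Set (Fin L)))
    (hsub : ∀ i ∈ Ph, lpath i ⊆ Lept) (hcl : ∀ i ∈ Ph, i ∈ M.closure (lpath i : Set (Fin L)))
    {T : Finset (Fin L)} (hT : M.IsBase (T : Set (Fin L))) (hTL : T ≠ Lept) :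
    ∃ i ∈ Ph, i ∈ T ∧ i ∉ Lept ∧ ∃ j ∈ lpath i, j ∉ T ∧
      M.IsBase ((insert j (T.erase i) : Finset (Fin L)) : Set (Fin L)) ∧
      treeShare M z T ≤ z j / (z j + z i) := by
  -- "there exists i ∈ Ph(E(G)) such that i ∈ T (because T = Lept(E(G)) is cancelled)": a 1-tree other than Lept is not
  -- contained in Lept (all 1-trees have the same number of lines)
  obtain ⟨i, hiT, hiL⟩ : ∃ i ∈ T, i ∉ Lept := by
    by_contra h
    push Not at h
    have hcard : T.card = Lept.card := by
      have h' := hT.ncard_eq_ncard_of_isBase hLept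
      simpa [Set.ncard_coe_finset] using h'
    exact hTL (eq_of_subset_of_card_le (fun x hx => h x hx) hcard.ge)
  have hiP : i ∈ Ph := hcover i hiL
  have hiX : i ∉ lpath i := fun h => hiL (hsub i hiP h)
  have hXE : ((lpath i : Finset (Fin L)) : Set (Fin L)) ⊆ M.E :=
    (coe_subset.2 (hsub i hiP)).trans hLept.subset_ground
  obtain ⟨j, hjX, hjT, hB⟩ := exists_exchange_of_mem_closure hT (mem_coe.2 hiT) hXE
    (fun h => hiX (mem_coe.1 h)) (hcl i hiP)
  have hjT' : j ∉ T := fun h => hjT (mem_coe.2 h)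
  have hB' : M.IsBase ((insert j (T.erase i) : Finset (Fin L)) : Set (Fin L)) := by
    rwa [coe_insert, coe_erase]
  exact ⟨i, hiP, hiT, hiL, j, mem_coe.1 hjX, hjT', hB', treeShare_le_of_exchange M z hz hT hiT hjT' hB'⟩

/-- **Lemma 3.9's core in the printed form**: for every 1-tree `T ≠ Lept(E(G))` there is a photon `i ∈ T` with
`X′_T ≤ z′_i / max(z′_i, z_i)`, `z′_i = max_{l∈LPath(i)} z_l` — "X′_T ≤ 1/(1 + z_i/z_j) = 1 − z_i/(z_i+z_j) ≤ 1 − z_i/(z_i+z′_i) =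
z′_i/(z_i+z′_i) ≤ z′_i/max(z_i,z′_i)". [cite: Volkov2020, proof of Lemma 3.9 (journal p.16–17; arXiv:1912.04885v4 tex l.545–556)] -/
theorem lemma39_core_printed (M : Matroid (Fin L)) (z : Fin L → ℝ) (hz : ∀ k, 0 < z k)
    (Ph Lept : Finset (Fin L)) (lpath : Fin L → Finset (Fin L))
    (hcover : ∀ l, l ∉ Lept → l ∈ Ph) (hLept : M.IsBase (Lept : Set (Fin L)))
    (hsub : ∀ i ∈ Ph, lpath i ⊆ Lept) (hcl : ∀ i ∈ Ph, i ∈ M.closure (lpath i : Set (Fin L)))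
    {T : Finset (Fin L)} (hT : M.IsBase (T : Set (Fin L))) (hTL : T ≠ Lept) :
    ∃ i ∈ Ph, i ∈ T ∧
      treeShare M z T ≤ lineMax z (lpath i) / max (lineMax z (lpath i)) (z i) := by
  obtain ⟨i, hiP, hiT, -, j, hj, -, -, hle⟩ := lemma39_core M z hz Ph Lept lpath hcover hLept hsub hcl hT hTL
  have hchain := div_add_le_div_max (hz j) (le_lineMax z hj) (hz i)
  exact ⟨i, hiP, hiT, hle.trans (hchain.1.trans hchain.2)⟩

/-- **The display (3.11)'s right-hand side**: `X′_T ≤ max_{i∈Ph(E(G))} z′_i/max(z′_i, z_i)` for every 1-tree `T ≠ Lept(E(G))`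
(the maximum over the photons, which exist as soon as such a `T` does). [cite: Volkov2020, Lemma 3.9 eq. (3.11) (journal p.16; arXiv:1912.04885v4 tex l.525–531)] -/
theorem lemma39_core_max (M : Matroid (Fin L)) (z : Fin L → ℝ) (hz : ∀ k, 0 < z k)
    (Ph Lept : Finset (Fin L)) (lpath : Fin L → Finset (Fin L))
    (hcover : ∀ l, l ∉ Lept → l ∈ Ph) (hLept : M.IsBase (Lept : Set (Fin L)))
    (hsub : ∀ i ∈ Ph, lpath i ⊆ Lept) (hcl : ∀ i ∈ Ph, i ∈ M.closure (lpath i : Set (Fin L)))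
    {T : Finset (Fin L)} (hT : M.IsBase (T : Set (Fin L))) (hTL : T ≠ Lept) (hPh : Ph.Nonempty) :
    treeShare M z T ≤ Ph.sup' hPh fun i => lineMax z (lpath i) / max (lineMax z (lpath i)) (z i) := by
  obtain ⟨i, hiP, -, hle⟩ := lemma39_core_printed M z hz Ph Lept lpath hcover hLept hsub hcl hT hTL
  exact hle.trans (le_sup' (fun i => lineMax z (lpath i) / max (lineMax z (lpath i)) (z i)) hiP)

end Core

/-! ## §4 The graph input discharged: incidence vectors and the cycle matroid of an edge list -/

section VectorClosure

open Literature.Combinatorics.Matroid (vectorMatroid vectorMatroid_indep_iff span_image_eq_of_isBasis)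

variable {ι K W : Type*} [DivisionRing K] [AddCommGroup W] [Module K W]

/-- In a vector matroid, an index whose vector lies in the span of the vectors of `X` is in the closure of `X` (Oxley 2011 §1.4:
closure in `M[A]` = the columns spanned by the columns of `X`). [cite: Oxley2011, §1.4 (rank and closure of a vector matroid)] -/
theorem mem_closure_vectorMatroid_of_mem_span (v : ι → W) (E : Set ι) {X : Set ι} (hX : X ⊆ E) {e : ι}
    (he : e ∈ E) (hv : v e ∈ Submodule.span K (v '' X)) : e ∈ (vectorMatroid K v E).closure X := by
  obtain ⟨I, hI⟩ := (vectorMatroid K v E).exists_isBasis X hX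
  rw [← hI.closure_eq_closure]
  by_cases heI : e ∈ I
  · exact (vectorMatroid K v E).mem_closure_of_mem heI hI.indep.subset_ground
  rw [hI.indep.mem_closure_iff_of_notMem heI, Matroid.dep_iff]
  refine ⟨fun h => ?_, Set.insert_subset he hI.indep.subset_ground⟩
  have hli := ((vectorMatroid_indep_iff v E).1 h).2
  rw [span_image_eq_of_isBasis v E hI] at hv
  exact ((linearIndepOn_insert heI).1 hli).2 hv

end VectorClosure

section EdgeList

open Literature.Combinatorics.Matroid (vectorMatroid vectorMatroid_indep_iff)

variable {N V : ℕ}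

/-- The reduced incidence vector of the vertex `n` (root `0` deleted): `δ_n(j) = [n = j+1]`, columns `j : Fin V` = vertices
`1,…,V`; `δ_0 = 0`. [cite: Brown2009FeynmanPeriods, §2.2 (ℰ_G with the root column deleted)] -/
def vtx (V : ℕ) (n : ℕ) : Fin V → ℚ := fun j => if n = (j : ℕ) + 1 then 1 else 0

/-- A line running `a → b` (as vertex numbers) has reduced incidence row `δ_a − δ_b`. [cite: Brown2009FeynmanPeriods, §2.2 (ε_{e,v})] -/
theorem reducedIncidence_eq_vtx_sub (E : Fin N → Fin (V + 1) × Fin (V + 1)) (e : Fin N) {a b : ℕ}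
    (h1 : ((E e).1 : ℕ) = a) (h2 : ((E e).2 : ℕ) = b) : reducedIncidence ℚ E e = vtx V a - vtx V b := by
  ext j
  rw [reducedIncidence_apply, Pi.sub_apply]
  have key : ∀ x : Fin (V + 1), (x = j.succ) ↔ ((x : ℕ) = (j : ℕ) + 1) := fun x => by
    rw [Fin.ext_iff, Fin.val_succ]
  simp only [key, h1, h2, vtx]

/-- Telescoping along a lepton path `a → a+1 → ⋯ → b`: `Σ_{a ≤ m < b} (δ_m − δ_{m+1}) = δ_a − δ_b`. [folklore] -/
private theorem sum_Ico_vtx (V : ℕ) {a b : ℕ} (hab : a ≤ b) :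
    ∑ m ∈ Finset.Ico a b, (vtx V m - vtx V (m + 1)) = vtx V a - vtx V b := by
  induction b, hab using Nat.le_induction with
  | base => simp
  | succ n hn ih => rw [Finset.sum_Ico_succ_top hn, ih]; abel

/-- **ε(photon) = Σ ε(lepton lines of its path).** If the line `i` runs `a → b` (`a ≤ b`) and for every `a ≤ m < b` a line `lep m`
runs `m → m+1` (the lepton path between the ends of the photon `i`, "the vertexes v₁,…,v_n of the lepton path connecting the ends of i
ordered along it"), then the incidence row of `i` is the sum of the rows of the `lep m`. [cite: Volkov2020, proof of Lemma 3.9 (journal p.16–17; arXiv:1912.04885v4 tex l.549–551)] -/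
theorem reducedIncidence_eq_sum_path (E : Fin N → Fin (V + 1) × Fin (V + 1)) {i : Fin N} {a b : ℕ} (hab : a ≤ b)
    (ha : ((E i).1 : ℕ) = a) (hb : ((E i).2 : ℕ) = b) (lep : ℕ → Fin N)
    (hlep : ∀ m, a ≤ m → m < b → ((E (lep m)).1 : ℕ) = m ∧ ((E (lep m)).2 : ℕ) = m + 1) :
    reducedIncidence ℚ E i = ∑ m ∈ Finset.Ico a b, reducedIncidence ℚ E (lep m) := by
  rw [reducedIncidence_eq_vtx_sub E i ha hb, ← sum_Ico_vtx V hab]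
  refine Finset.sum_congr rfl fun m hm => ?_
  obtain ⟨h1, h2⟩ := hlep m (Finset.mem_Ico.1 hm).1 (Finset.mem_Ico.1 hm).2
  exact (reducedIncidence_eq_vtx_sub E (lep m) h1 h2).symm

/-- **The photon lies in the closure of its lepton path** in the cycle matroid of the edge list (the tree's `cycleMatroid`,
`QuantumFieldTheory/HeppBound.lean`): the hypothesis `hcl` of `lemma39_core` DISCHARGED for graphs — "the ends v₁ and v_n of i belong
to different connectivity components of T∖i. Therefore, there exists b such that v_b, v_{b+1} belong to the different connectivity
components", i.e. the photon and its lepton path form a cycle. [cite: Volkov2020, proof of Lemma 3.9 (journal p.16–17; arXiv:1912.04885v4 tex l.549–552)] -/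
theorem mem_closure_cycleMatroid_of_path (E : Fin N → Fin (V + 1) × Fin (V + 1)) {i : Fin N} {a b : ℕ} (hab : a ≤ b)
    (ha : ((E i).1 : ℕ) = a) (hb : ((E i).2 : ℕ) = b) (lep : ℕ → Fin N)
    (hlep : ∀ m, a ≤ m → m < b → ((E (lep m)).1 : ℕ) = m ∧ ((E (lep m)).2 : ℕ) = m + 1)
    (P : Finset (Fin N)) (hP : ∀ m, a ≤ m → m < b → lep m ∈ P) :
    i ∈ (cycleMatroid E).closure (P : Set (Fin N)) := by
  refine mem_closure_vectorMatroid_of_mem_span (fun e => reducedIncidence ℚ E e) Set.univ (Set.subset_univ _)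
    (Set.mem_univ i) ?_
  show reducedIncidence ℚ E i ∈ Submodule.span ℚ ((fun e => reducedIncidence ℚ E e) '' (P : Set (Fin N)))
  rw [reducedIncidence_eq_sum_path E hab ha hb lep hlep]
  refine Submodule.sum_mem _ fun m hm => Submodule.subset_span ⟨lep m, ?_, rfl⟩
  exact Finset.mem_coe.2 (hP m (Finset.mem_Ico.1 hm).1 (Finset.mem_Ico.1 hm).2)

/-- **The lepton path is a 1-tree**: for an edge list on the vertices `0,…,V` with lines `lep m : m → m+1` (`m < V`), the set of these
lines is a base of the cycle matroid (its incidence rows `δ_m − δ_{m+1}` span `ℚ^V`: `e_j = −Σ_{m ≤ j}(δ_m − δ_{m+1})`, and there are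
`V = dim` of them) — the hypothesis `hLept` of `lemma39_core` DISCHARGED for graphs ("T = Lept(E(G))", a 1-tree).
[cite: Volkov2020, proof of Lemma 3.9 (journal p.16; arXiv:1912.04885v4 tex l.545–549)] -/
theorem isBase_cycleMatroid_path (E : Fin N → Fin (V + 1) × Fin (V + 1)) (lep : Fin V → Fin N)
    (hinj : Function.Injective lep) (hlep : ∀ m : Fin V, ((E (lep m)).1 : ℕ) = m ∧ ((E (lep m)).2 : ℕ) = m + 1) :
    (cycleMatroid E).IsBase (Set.range lep) := by
  classical
  set v : Fin N → (Fin V → ℚ) := fun e => reducedIncidence ℚ E e with hv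
  have hM : cycleMatroid E = vectorMatroid ℚ v Set.univ := rfl
  have hrow : ∀ m : Fin V, v (lep m) = vtx V m - vtx V (m + 1) := fun m =>
    reducedIncidence_eq_vtx_sub E (lep m) (hlep m).1 (hlep m).2
  -- every coordinate vector lies in the span of the path rows
  have hspan : ⊤ ≤ Submodule.span ℚ (Set.range (v ∘ lep)) := by
    refine (Submodule.eq_top_iff'.2 fun x => ?_).ge
    rw [pi_eq_sum_univ x]
    refine Submodule.sum_mem _ fun j _ => Submodule.smul_mem _ _ ?_
    have hb : (fun j' : Fin V => if j = j' then (1 : ℚ) else 0) = vtx V ((j : ℕ) + 1) := by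
      ext j'
      simp [vtx, Fin.ext_iff]
    have h0 : vtx V 0 = 0 := by
      ext j'
      simp [vtx]
    have hsum : vtx V ((j : ℕ) + 1) = -∑ m ∈ Finset.range ((j : ℕ) + 1), (vtx V m - vtx V (m + 1)) := by
      rw [Finset.range_eq_Ico, sum_Ico_vtx V (Nat.zero_le _), h0, zero_sub, neg_neg]
    rw [hb, hsum]
    refine Submodule.neg_mem _ (Submodule.sum_mem _ fun m hm => ?_)
    have hmV : m < V := lt_of_lt_of_le (Finset.mem_range.1 hm) j.isLt
    have hm' : vtx V m - vtx V (m + 1) = (v ∘ lep) ⟨m, hmV⟩ := by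
      simp only [Function.comp_apply, hrow]
    rw [hm']
    exact Submodule.subset_span ⟨⟨m, hmV⟩, rfl⟩
  have hcard : Fintype.card (Fin V) = Module.finrank ℚ (Fin V → ℚ) := by
    rw [Module.finrank_fintype_fun_eq_card]
  have hli : LinearIndependent ℚ (v ∘ lep) := linearIndependent_of_top_le_span_of_card_eq_finrank hspan hcard
  have hind : (cycleMatroid E).Indep (Set.range lep) := by
    rw [hM, vectorMatroid_indep_iff]
    exact ⟨Set.subset_univ _, (linearIndepOn_range_iff hinj v).2 hli⟩
  refine hind.isBase_of_maximal fun J hJ hIJ => ?_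
  have hJli : LinearIndepOn ℚ v J := by
    rw [hM, vectorMatroid_indep_iff] at hJ
    exact hJ.2
  haveI : Fintype J := Fintype.ofFinite J
  have hJcard : Fintype.card J ≤ V := by
    have h := hJli.linearIndependent.fintype_card_le_finrank
    simpa [Module.finrank_fintype_fun_eq_card] using h
  have hIcard : (Set.range lep).ncard = V := by
    rw [← Set.image_univ, Set.ncard_image_of_injective _ hinj, Set.ncard_univ, Nat.card_eq_fintype_card,
      Fintype.card_fin]
  refine Set.eq_of_subset_of_ncard_le hIJ ?_ (Set.toFinite J)
  rw [hIcard, Set.ncard_eq_toFinset_card' J, Set.toFinset_card]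
  exact hJcard

end EdgeList

/-! ## §5 Non-vacuity: the one-loop vertex graph -/

section OneLoop

/-- The one-loop vertex graph as an edge list on the vertices `0, 1, 2` (the lepton path `0 → 1 → 2`, external photon at `1`):
line `0` = lepton `a : 0 → 1`, line `1` = lepton `b : 1 → 2`, line `2` = the photon `γ : 0 → 2`.
[cite: Volkov2020, §2.1 (journal p.6–7; arXiv:1912.04885v4 tex l.127–170)] -/
def oneLoopEdges : Fin 3 → Fin 3 × Fin 3 := ![((0 : Fin 3), 1), (1, 2), (0, 2)]

/-- The lepton path `{a, b}` is a 1-tree of the one-loop graph (an instance of `isBase_cycleMatroid_path`).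
[cite: Volkov2020, proof of Lemma 3.9 (journal p.16; arXiv:1912.04885v4 tex l.545–549)] -/
theorem oneLoop_isBase_lept :
    (cycleMatroid oneLoopEdges).IsBase ((({0, 1} : Finset (Fin 3)) : Set (Fin 3))) := by
  have h := isBase_cycleMatroid_path oneLoopEdges (Fin.castSucc : Fin 2 → Fin 3) (Fin.castSucc_injective 2)
    (by decide)
  have hr : Set.range (Fin.castSucc : Fin 2 → Fin 3) = ((({0, 1} : Finset (Fin 3)) : Set (Fin 3))) := by
    ext x
    rw [Fin.range_castSucc, Set.mem_setOf_eq, Finset.coe_insert, Finset.coe_singleton, Set.mem_insert_iff,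
      Set.mem_singleton_iff]
    fin_cases x <;> simp
  rwa [hr] at h

/-- The photon `γ` lies in the closure of its lepton path `{a, b}` (an instance of `mem_closure_cycleMatroid_of_path`).
[cite: Volkov2020, proof of Lemma 3.9 (journal p.16–17; arXiv:1912.04885v4 tex l.549–552)] -/
theorem oneLoop_photon_mem_closure :
    (2 : Fin 3) ∈ (cycleMatroid oneLoopEdges).closure ((({0, 1} : Finset (Fin 3)) : Set (Fin 3))) := by
  refine mem_closure_cycleMatroid_of_path oneLoopEdges (i := 2) (a := 0) (b := 2) (by norm_num) rfl rfl
    (fun m => if m = 0 then 0 else 1) (fun m _ hm => ?_) {0, 1} (fun m _ hm => ?_)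
  · interval_cases m <;> decide
  · interval_cases m <;> decide

/-- **Lemma 3.9's core on the one-loop vertex graph** (non-vacuity of `lemma39_core_printed`): for all positive `z`, every 1-tree
`T ≠ {a, b}` (i.e. `T = {a, γ}` or `{b, γ}`) satisfies `X′_T ≤ z′_γ / max(z′_γ, z_γ)` with `z′_γ = max(z_a, z_b)`.
[cite: Volkov2020, proof of Lemma 3.9 (journal p.16–17; arXiv:1912.04885v4 tex l.545–556)] -/
theorem oneLoop_lemma39_core (z : Fin 3 → ℝ) (hz : ∀ k, 0 < z k) {T : Finset (Fin 3)}
    (hT : (cycleMatroid oneLoopEdges).IsBase (T : Set (Fin 3))) (hTL : T ≠ {0, 1}) :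
    treeShare (cycleMatroid oneLoopEdges) z T ≤
      lineMax z {0, 1} / max (lineMax z {0, 1}) (z 2) := by
  obtain ⟨i, hi, -, hle⟩ := lemma39_core_printed (cycleMatroid oneLoopEdges) z hz {2} {0, 1} (fun _ => {0, 1})
    (by decide) oneLoop_isBase_lept (fun _ _ => le_refl _)
    (fun i hi => by rw [Finset.mem_singleton] at hi; subst hi; exact oneLoop_photon_mem_closure) hT hTL
  rw [Finset.mem_singleton] at hi
  subst hi
  exact hle

end OneLoop

/-! ## §6 The coefficients of Q″_l = (Q_l(z) − q_l D(z))/D(z): a weighted sum of the shares X′_T of the NON-cancelled 1-trees -/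

section Coefficients

variable {L : ℕ}

/-- **A coefficient of Q″_l AS PRINTED.** «Q_l(z) = Σ_T p[T] ∏_{l′∈E(G)∖T} z_{l′}, where the summation goes over all 1-trees T containing l»
(§2.2.1) and «Q″_l = (Q_l(z) − q_l D(z))/D(z). Both terms of the numerator can be expressed as sums of the form Σ_T c(T)∏_{l∈E(G)∖T} z_l, where the
summation goes over 1-trees T of G, the coefficients c(T) are linear combinations of p₁, p₂»: fixing one of the two coordinates (p₁ or p₂), `c T` is
that coordinate of p[T] (T ∋ l) and `c₀` that of q_l; `qCoeff` is the corresponding coordinate of Q″_l.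
[cite: Volkov2020, §2.2.1 (journal p.8; arXiv:1912.04885v4 tex l.226–231); proof of Lemma 3.9 (journal p.16; tex l.541–546)] -/
def qCoeff (M : Matroid (Fin L)) (z : Fin L → ℝ) (l : Fin L) (c : Finset (Fin L) → ℝ) (c₀ : ℝ) : ℝ :=
  (∑ T ∈ (oneTrees M).filter (fun T => l ∈ T), c T * ∏ k ∈ univ \ T, z k - c₀ * treeSum M z) / treeSum M z

/-- The weight of the 1-tree T in that coordinate of Q″_l: c(T) − c₀ if l ∈ T, −c₀ if l ∉ T.
[cite: Volkov2020, proof of Lemma 3.9 (journal p.16; arXiv:1912.04885v4 tex l.543–546)] -/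
def qWeight (l : Fin L) (c : Finset (Fin L) → ℝ) (c₀ : ℝ) (T : Finset (Fin L)) : ℝ :=
  (if l ∈ T then c T else 0) - c₀

/-- «The terms corresponding to T are cancelled if l ∈ T and the momentum passing through l in T equals q_l» (same coordinate).
[cite: Volkov2020, proof of Lemma 3.9 (journal p.16; arXiv:1912.04885v4 tex l.545–546)] -/
theorem qWeight_eq_zero_of_cancel {l : Fin L} {c : Finset (Fin L) → ℝ} {c₀ : ℝ} {T : Finset (Fin L)}
    (hl : l ∈ T) (hc : c T = c₀) : qWeight l c c₀ T = 0 := by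
  unfold qWeight
  rw [if_pos hl, hc, sub_self]

/-- |weight| ≤ |c(T)| + |c₀|. [cite: Volkov2020, proof of Lemma 3.9 (journal p.16; arXiv:1912.04885v4 tex l.543–546)] -/
theorem abs_qWeight_le (l : Fin L) (c : Finset (Fin L) → ℝ) (c₀ : ℝ) (T : Finset (Fin L)) :
    |qWeight l c c₀ T| ≤ |c T| + |c₀| := by
  unfold qWeight
  split_ifs with h
  · exact abs_sub _ _
  · rw [zero_sub, abs_neg]
    exact le_add_of_nonneg_left (abs_nonneg _)

/-- The coordinate of Q″_l is the weighted sum of the shares: Σ_T (𝟙[l∈T]c(T) − c₀)·X′_T over ALL 1-trees T.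
[cite: Volkov2020, proof of Lemma 3.9 (journal p.16; arXiv:1912.04885v4 tex l.541–548)] -/
theorem qCoeff_eq_sum_qWeight_mul_treeShare (M : Matroid (Fin L)) (z : Fin L → ℝ) (l : Fin L)
    (c : Finset (Fin L) → ℝ) (c₀ : ℝ) :
    qCoeff M z l c c₀ = ∑ T ∈ oneTrees M, qWeight l c c₀ T * treeShare M z T := by
  unfold qCoeff qWeight treeShare
  rw [sum_filter, show c₀ * treeSum M z = ∑ T ∈ oneTrees M, c₀ * ∏ k ∈ univ \ T, z k by
    unfold treeSum; rw [mul_sum], ← sum_sub_distrib, sum_div]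
  refine sum_congr rfl fun T _ => ?_
  rw [show (if l ∈ T then c T * ∏ k ∈ univ \ T, z k else 0) = (if l ∈ T then c T else 0) * ∏ k ∈ univ \ T, z k by
      split_ifs <;> simp, sub_div, mul_div_assoc, mul_div_assoc, ← sub_mul]

/-- 0 ≤ X′_T for nonnegative parameters. [cite: Volkov2020, proof of Lemma 3.9 «X′_T = ∏ z_l / D(z)» (journal p.16; tex l.547–548)] -/
theorem treeShare_nonneg (M : Matroid (Fin L)) (z : Fin L → ℝ) (hz : ∀ k, 0 ≤ z k) (T : Finset (Fin L)) :
    0 ≤ treeShare M z T := by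
  unfold treeShare treeSum
  exact div_nonneg (prod_nonneg fun k _ => hz k) (sum_nonneg fun S _ => prod_nonneg fun k _ => hz k)

/-- **Lemma 3.9 at the level of the coefficients of Q″_l** («it is sufficient to estimate the coefficients of Q″_l»): in the setting of
`lemma39_core` (Lept a 1-tree, photons with lepton paths), for a lepton line l ∈ Lept, coordinates c(T) of p[T] and c₀ of q_l with |c(T)| ≤ 1,
|c₀| ≤ 1 («linear combinations of p₁, p₂» — for a vertex graph p[T] ∈ {0, ±p₁, ±p₂, ±q}) and c(Lept) = c₀ («T = Lept(E(G)) is cancelled»: the momentum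
through l in the lepton tree is q_l by the definition of q_l), the coordinate of Q″_l satisfies
|coordinate| ≤ 2(#1-trees − 1) · max_{i∈Ph} z′_i/max(z′_i, z_i) — the right-hand side of (3.11) with an explicit structure constant.
[cite: Volkov2020, Lemma 3.9 (3.11) and its proof (journal p.16–17; arXiv:1912.04885v4 tex l.525–556)] -/
theorem abs_qCoeff_le (M : Matroid (Fin L)) (z : Fin L → ℝ) (hz : ∀ k, 0 < z k)
    (Ph Lept : Finset (Fin L)) (lpath : Fin L → Finset (Fin L))
    (hcover : ∀ l, l ∉ Lept → l ∈ Ph) (hLept : M.IsBase (Lept : Set (Fin L)))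
    (hsub : ∀ i ∈ Ph, lpath i ⊆ Lept) (hcl : ∀ i ∈ Ph, i ∈ M.closure (lpath i : Set (Fin L))) (hPh : Ph.Nonempty)
    {l : Fin L} (hl : l ∈ Lept) (c : Finset (Fin L) → ℝ) (c₀ : ℝ) (hc : ∀ T, |c T| ≤ 1) (hc₀ : |c₀| ≤ 1)
    (hcancel : c Lept = c₀) :
    |qCoeff M z l c c₀| ≤
      2 * (((oneTrees M).card - 1 : ℕ) : ℝ) * Ph.sup' hPh fun i => lineMax z (lpath i) / max (lineMax z (lpath i)) (z i) := by
  set B : ℝ := Ph.sup' hPh fun i => lineMax z (lpath i) / max (lineMax z (lpath i)) (z i) with hB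
  have hLmem : Lept ∈ oneTrees M := (mem_oneTrees M).2 hLept
  rw [qCoeff_eq_sum_qWeight_mul_treeShare M z, ← add_sum_erase _ _ hLmem,
    qWeight_eq_zero_of_cancel hl hcancel, zero_mul, zero_add]
  -- every remaining 1-tree T ≠ Lept: |weight| ≤ 2 and 0 ≤ X′_T ≤ B
  have hterm : ∀ T ∈ (oneTrees M).erase Lept, |qWeight l c c₀ T * treeShare M z T| ≤ 2 * B := by
    intro T hT
    obtain ⟨hTL, hTmem⟩ := mem_erase.1 hT
    have hTb : M.IsBase (T : Set (Fin L)) := (mem_oneTrees M).1 hTmem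
    have hX0 : 0 ≤ treeShare M z T := treeShare_nonneg M z (fun k => (hz k).le) T
    have hXB : treeShare M z T ≤ B := lemma39_core_max M z hz Ph Lept lpath hcover hLept hsub hcl hTb hTL hPh
    have hw : |qWeight l c c₀ T| ≤ 2 := by
      have := abs_qWeight_le l c c₀ T
      linarith [hc T, hc₀]
    rw [abs_mul, abs_of_nonneg hX0]
    calc |qWeight l c c₀ T| * treeShare M z T ≤ 2 * treeShare M z T :=
          mul_le_mul_of_nonneg_right hw hX0
      _ ≤ 2 * B := mul_le_mul_of_nonneg_left hXB (by norm_num)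
  calc |∑ T ∈ (oneTrees M).erase Lept, qWeight l c c₀ T * treeShare M z T|
      ≤ ∑ T ∈ (oneTrees M).erase Lept, |qWeight l c c₀ T * treeShare M z T| := abs_sum_le_sum_abs _ _
    _ ≤ ∑ T ∈ (oneTrees M).erase Lept, 2 * B := sum_le_sum hterm
    _ = 2 * (((oneTrees M).card - 1 : ℕ) : ℝ) * B := by
        rw [sum_const, card_erase_of_mem hLmem, nsmul_eq_mul]; ring

/-- Non-vacuity on the one-loop vertex graph: with its three 1-trees, every coordinate of Q″_l (l = a or b) is bounded by
4·z′_γ/max(z′_γ, z_γ). [cite: Volkov2020, Lemma 3.9 (3.11) (journal p.16; arXiv:1912.04885v4 tex l.525–531)] -/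
theorem oneLoop_abs_qCoeff_le (z : Fin 3 → ℝ) (hz : ∀ k, 0 < z k) {l : Fin 3} (hl : l ∈ ({0, 1} : Finset (Fin 3)))
    (c : Finset (Fin 3) → ℝ) (c₀ : ℝ) (hc : ∀ T, |c T| ≤ 1) (hc₀ : |c₀| ≤ 1) (hcancel : c {0, 1} = c₀) :
    |qCoeff (cycleMatroid oneLoopEdges) z l c c₀| ≤
      2 * (((oneTrees (cycleMatroid oneLoopEdges)).card - 1 : ℕ) : ℝ) *
        (lineMax z {0, 1} / max (lineMax z {0, 1}) (z 2)) := by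
  have h := abs_qCoeff_le (cycleMatroid oneLoopEdges) z hz {2} {0, 1} (fun _ => {0, 1}) (by decide) oneLoop_isBase_lept
    (fun _ _ => le_refl _) (fun i hi => by rw [Finset.mem_singleton] at hi; subst hi; exact oneLoop_photon_mem_closure)
    (singleton_nonempty 2) hl c c₀ hc hc₀ hcancel
  simpa only [sup'_singleton] using h

end Coefficients

end

end Literature.MathematicalPhysics.QuantumFieldTheory.Volkov2020
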